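import Mathlib
import HarnessLib
import HarnessLib.Audit
import Summits.NavierStokesRegularity.Statement
import Summits.NavierStokesRegularity.NavierStokesRegularity.Theorems.NoBlowupToClay
import Literature.Analysis.FluidPDE.ClassicalSolution
import Literature.Analysis.FluidPDE.LerayHopf
import Literature.Analysis.FluidPDE.SuitableWeak
import Literature.Analysis.FluidPDE.SelfSimilar
import Literature.Analysis.FluidPDE.VectorCalculus
import Summits.NavierStokesRegularity.NavierStokesRegularity.Theorems.TypeIQuarterGateQuarterLawTypeIStubLorentzCount
import HarnessLib.Audit.Status.Attr

/-!
Route: TypeIQuarterGate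

# Route TypeIQuarterGate — Leray's quarter rate on Type-I blow-ups feeds Galdi's parabolic Liouville
class

X = QuarterLawTypeI ∧ ParabolicGaldiLiouville ∧ NoTypeII ("it suffices to show X"). Leray's lower
bound ∫|∇u(t)|² ≥ c ν^(3/2)(T−t)^(−1/2) is an EXTREMAL law; mining its saturating configurations
shows that a blow-up which keeps the matching UPPER bound ∫|curl u(t)|² ≤ K(T−t)^(−1/2) (the quarter
law) AND the Type-I sup-norm rate has KNSS zoom limits that are bounded ancient mild solutions with
UNIFORMLY BOUNDED ENSTROPHY and L⁶ slices — exactly the finite-Dirichlet class of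
GaldiLiouvilleGate's parabolic Liouville theorem (stmt-0893). So Clay (A) follows from: (K1,
attacked) the quarter law restricted to Type-I blow-ups; (K2, residual, shared)
ParabolicGaldiLiouville stmt-0893; (K3, residual, shared) NoTypeII stmt-0056; plus the bookkeeping
support QuarterZoom (KNSS zoom + lower semicontinuity of the Ḣ¹ seminorm), which REPLACES
GaldiLiouvilleGate's open record-zoom crux stmt-0894 on the Type-I side. No summit is proved by this
line; it is a LINE with two declared residual hard cores.
Lean: `QuarterLawTypeI ∧ ParabolicGaldiLiouville ∧ NoTypeII` with `QuarterLawTypeI := ∀ (ν T : ℝ), 0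
< ν → 0 < T → ∀ (u : ℝ → EuclideanSpace ℝ (Fin 3) → EuclideanSpace ℝ (Fin 3)) (p : ℝ →
EuclideanSpace ℝ (Fin 3) → ℝ), Literature.Analysis.FluidPDE.IsMaximalSmoothSolution ν 0 u p T →
Literature.Analysis.FluidPDE.IsLerayHopfOn T ν 0 (u 0) u →
Literature.Analysis.FluidPDE.HasRapidSpatialDecay (u 0) → Literature.Analysis.FluidPDE.IsTypeIBlowup
u T → ∃ K : ℝ, ∀ t ∈ Set.Ico 0 T, ∫⁻ x, ‖Literature.Analysis.FluidPDE.curl (u t) x‖ₑ ^ 2 ≤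
ENNReal.ofReal (K / Real.sqrt (T - t))`

## Assembly
Pure logic modulo the in-tree reduction NoBlowup ⇒ Clay (Theorems.navierStokesRegularity_of_noBlowup
/ typeICertificateLadder_noBlowupToClay_proof): if a rapidly-decaying-datum Leray–Hopf classical
solution does not extend past T, QuarterZoom (fed by NoTypeII and QuarterLawTypeI) yields a
nontrivial smooth bounded ancient mild solution with enstrophy ≤ 1 and L⁶ slices, which
ParabolicGaldiLiouville (with C = 1) forces to vanish — contradiction. Certified as `closes` in
glue.lean; `assembly_of_noBlowupToClay` in Sketch.lean checks the shape (rc 0).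

Rationale: WHY THIS LINE. Technique card «extremal-example mining»: the objects that SATURATE Leray's rate Z(t)
~ (T−t)^(−1/2) are finite constellations of lone Type-I scars whose similarity profiles have finite
enstrophy ∫|∇V|² < ∞ (scaling: ∫|∇u(t)|² dx = (T−t)^(−1/2) ∫|∇U(s)|² dy); the quarter law fails
exactly by (i) Type-II concentration (λ(t) ≪ √(T−t) gives Z ~ λ^(−1) ≫ (T−t)^(−1/2)), (ii)
infinitely many scars at the blow-up time, (iii) 'satellite' near-singularities riding the scar at
all scales (profile with a second scar on the unit sphere, log-divergent enstrophy). (ii) is settled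
under the Lorentz-space Type-I bound sup_t ‖u‖_(L^(3,∞)) ≤ M [corpus:paper:arxiv-2111.14776 p.3–4:
at most C·M^20 singular points at a first blow-up time, after ChoeWolfYang2018] but open under the
sup-norm rate `IsTypeIBlowup`; (iii) is new typed content. The pay-off is a BRIDGE between two
existing shelves that do not talk to each other: the quarter-law shelf (stmt-1574:
StretchingWellBinding, LerayQuarterDissipation, EfficiencyFloor use it as a CEILING) and Galdi's
gate (route GaldiLiouvilleGate: ParabolicGaldiLiouville 0893 fed by the record zoom 0894, whose
thin-slow branch is open): restricted to Type-I blow-ups, the quarter law is precisely the CLASS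
CERTIFICATE that puts the KNSS profile (KochNadirashviliSereginSverak2009 §6, arXiv:0709.3599; in
tree KNSS2009_blowup_generates_ancient_holds) into Galdi's finite-Dirichlet class, with no record
clock and no production-forces-concentration lemma. Imported areas: parabolic blow-up/compactness
(KNSS, AlbrittonBarker2019 arXiv:1811.00502 Lemma 2.5 for local Type-I quantities from the rate),
ε-regularity counting of singular points (Seregin2001 doi:10.1002/cpa.3002, arXiv:2111.14776),
Liouville rigidity in decay classes (Galdi2011 X.9, Seregin2016, WangYang2026). What prior routes do
not do: GaldiLiouvilleGate zooms at enstrophy RECORDS for all blow-ups (0894 open on the thin-slow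
branch); TypeILiouville/RecurrentProfiles feed the structureless bounded class of (L) (stmt-10661);
the 1574 shelf uses the quarter law only as a contradiction ceiling. Negatives index (5 entries
2026-08-27): none concerns enstrophy rates or Type-I profiles. BOOKING IDENTITY (critic idea-crit-3
P1, accepted 2026-08-28): modulo this route's OWN residual NoTypeII (every maximal solution is
Type-I), K1 ∧ 0056 ⟺ 1574 ∧ 0056 — inside the residual frame the attacked crux is the shelf residual
1574 restricted to Type-I; book the line as the FOURTH line on the 1574 shelf with a GALDI BACK END
(0893 replaces FDL 22144 / PED 22866 / SuperlogTypeIRate 23361 as back end), double residual 0893 ∧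
0056 — not as an independent attack. Its kernel-reachable content: the bridge QuarterZoom
(stmt-23727, PROVED 2026-08-27T23:50Z via GaldiLiouvilleGate's landed Type-I-enstrophy branch
RecordZoomAncient.Birth.stub_typeIBranch + recordZoomAncient_of_concentratedZooms — so K1 + NoTypeII
empty the open thin-slow/faint kernel branch of 0894), the split glue (stmt-23845, PROVED), the
K1-rung glue QuarterLawCountsScars (stmt-23912: the quarter law ⇒ finitely many scars, by CKN
Theorem B counting, provable now) and the envelope rung EnvelopeQuarterLaw (stmt-23844, PROVED
2026-08-28 p590655 by ns-tiqg-p1 — the landed BC5 rung of K1: the single-scar space-time envelope ⇒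
the quarter law).

RANKED CRUXES. #2 QuarterLawTypeI (crux) — Leray's quarter rate on Type-I blow-ups: a maximal
classical Leray–Hopf solution on ℝ³×[0,T) from a rapidly decaying datum with the Type-I sup-norm
rate has ∫|curl u(t)|² ≤ K/√(T−t) on [0,T) (EnstrophyQuarterLaw stmt-1574 restricted to
`IsTypeIBlowup`). [difficulty: XL] (why it might fail: a Type-I blow-up with infinitely many
singular points at T, or whose KNSS profile carries 'satellite' near-singular bumps at all scales (a
second scar on the unit sphere of the zoom limit), has Z√(T−t) → ∞ logarithmically while keeping the
sup-norm rate.) [arXiv:2111.14776, ChoeWolfYang2018, doi:10.1002/cpa.3002,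
KochNadirashviliSereginSverak2009, arXiv:1811.00502, Leray1934]
#3 ParabolicGaldiLiouville (crux) — RESIDUAL (= stmt-0893 of GaldiLiouvilleGate, verbatim): a
bounded ancient mild solution of NS (ν = 1) on ℝ³×(−∞,0), smooth, with uniformly bounded enstrophy
and L⁶ slices, vanishes identically. [difficulty: open-problem] (why it might fail: contains Galdi's
open steady Liouville problem (D-solutions; no decay rate beyond L⁶/L^(9/2) known) and the slow
|x|^(−a), a ∈ (1/2,2/3) tails; one nontrivial finite-enstrophy ancient or time-periodic flow refutes
it.) [Galdi2011, KochNadirashviliSereginSverak2009, Seregin2016, ChaeWolf2019, arXiv:2608.06040]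
#4 NoTypeII (crux) — RESIDUAL (= stmt-0056, verbatim): every maximal classical Leray–Hopf solution
from a rapidly decaying datum that fails to extend past T blows up at the Type-I sup-norm rate.
[difficulty: open-problem] (why it might fail: a Schwartz-data Type-II blow-up (Euler-driven
collapse faster than √(T−t), Hou-type scenarios; Tao's averaged cascade is Type-II) refutes it;
shared fate with TypeILiouville, RecurrentProfiles, ExtremiserTransience.)
[KochNadirashviliSereginSverak2009, arXiv:1402.0290, doi:10.1007/s10208-026-09748-8]
#9 QuarterZoom (support) — QUARTER ZOOM (bookkeeping): under NoTypeII and QuarterLawTypeI, a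
non-extendable Leray–Hopf classical solution from a rapidly decaying datum has a KNSS zoom limit
which is a NONTRIVIAL bounded ancient mild solution (ν = 1), smooth, with slice enstrophy ≤ 1 and L⁶
slices (conclusion = GaldiLiouvilleGate.RecordZoomAncient verbatim). Steps: KNSS zoom at the
sup-norm scale λ_k ~ √(T−t_k) (KNSS2009_blowup_generates_ancient_holds); ∫|∇u_λ|² = λ∫|∇u|² so the
quarter law gives ∫|∇v_k(s)|² ≤ K/√(1−s) ≤ K for s ≤ 0; weak lower semicontinuity of the Ḣ¹
seminorm; NS-rescale by K to normalise to 1; parabolic smoothing of bounded mild solutions; Ḣ¹ ∩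
(local L² average → 0 at infinity, from finite energy via A–B Lemma 2.5) ⇒ L⁶. [difficulty: L]
[KochNadirashviliSereginSverak2009, arXiv:1811.00502, Galdi2011]

TWO-LAYER PLAN. QuarterLawTypeI ⇐ LorentzUpgrade → ProfileEnvelope → QuarterLawTypeI, where
LorentzUpgrade: a sup-norm-rate Type-I Leray–Hopf blow-up has sup_t ‖u(t)‖_(L^(3,∞)) < ∞ (then
finitely many scars by arXiv:2111.14776 / ChoeWolfYang2018), and ProfileEnvelope: at each scar the
space-time envelope (|x−x_i| + √(T−t))|u| ≤ C' holds (⇔ the zoom limit has scar set {0} at its final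
time; gives |∇V| ≲ |y|^(−2) and finite profile enstrophy); the glue is the dyadic-annulus
bookkeeping Z_(B_δ(x_i))(t) ≲ Σ_j ρ_j^(−1) ≲ (T−t)^(−1/2). Both children are typed in the BC3
skeleton (stubs), not filed as items now. The negative companion 'TwinScarProfileExists' (a
local-energy Type-I ancient solution singular at two points at its final time) is the refuter's
target.

KILL CRITERIA. A Type-I (sup-norm rate) Leray–Hopf blow-up, or a local-energy Type-I ancient
solution with two scars at the final time / with infinite slice enstrophy, refutes QuarterLawTypeI ⇒
close `refuted:QuarterLawTypeI` (the bridge dies; GaldiLiouvilleGate keeps 0894). A nontrivial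
bounded ancient mild solution with bounded enstrophy and L⁶ slices refutes ParabolicGaldiLiouville
(shared fate with GaldiLiouvilleGate). A Schwartz-data Type-II blow-up refutes NoTypeII (= ¬Clay A
essentially). EnstrophyQuarterLaw stmt-1574 proved ⇒ QuarterLawTypeI becomes a corollary (route
survives, crux closes); RecordZoomAncient stmt-0894 proved ⇒ superseded by GaldiLiouvilleGate (close
`superseded`). INSTRUMENT HONESTY (critic P4): an NSI/Scheffer-style construction at the Type-I rate
with two final-time scars, and a profile-enstrophy census of 'satellite' profiles, are PLAUSIBILITY
INSTRUMENTS only (NSI ≠ NS); K1 is a consequence-crux whose only hard refutation is an actual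
blow-up. PRE-PLANNED REPAIR: the landed branch stub_typeIBranch needs only the SEQUENTIAL RECORD
quarter law (∀ t' < T ∃ t ∈ [t',T): max_{s≤t} Z(s) ≤ C ν^{3/2}/√(T−t)); if K1 (sup form) falls to
SPARSE satellites, the line continues with K1' = QuarterLawTypeISeq (Type-I ⇒ sequential record
quarter law) and the same zoom; dense satellites, twin-scar profiles or infinitely many scars kill
both forms.

NOT DECOMPOSED YET. The LorentzUpgrade / ProfileEnvelope split of QuarterLawTypeI (layer 2, after
the skeleton's first stub moves); the ν-normalisation and the L⁶-at-infinity step inside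
QuarterZoom; anything about ParabolicGaldiLiouville (GaldiLiouvilleGate owns its layer 2:
steady/time-periodic/eternal sub-rungs) and about NoTypeII. LINE D′ (2026-08-28, after critic
re-verdict on the gen-1 split): the envelope child ScarEnvelopeTypeI is a STRENGTHENING
(space-Type-I, open) and no longer on the critical path; the deciding reformulation of K1 is the
SCALE-UNIFORM ε-CONCENTRATION COUNT UniformConcentrationCountTypeI (stmt-23970, crux r3: under the
sup-norm Type-I rate, for every η > 0 a bound N, uniform over scales r ≤ r₀, on
pairwise-2r-separated points whose cylinders Q_r(x,T) carry (1/r)∬|∇u|²_F ≥ η — gauge-free; the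
printed L^{3,∞} form of arXiv:2111.14776 Thm 3), with the provable summation glue CountQuarterLaw
(stmt-23971, support: count + Type-I ⇒ quarter law by dyadic ε-regularity summation, |∇u(t,x)| ≤ C
r_k^{-2} off the doubled concentration balls at scale r_k = 8·2^k√(T−t), plus the Type-I gradient
bound on their N·O((T−t)^{3/2}) volume and a far-field enstrophy Gronwall; no envelope). S1′ ⇔ K1
modulo provable glue (K1 ⇒ S1′: N ≤ 2K/η); both are registered stubs of line uniform-count on 23726.
An operator/tenure `--resplit QuarterLawTypeI` into these two would make the item tree match the
line. LINE `lorentz-upgrade` (2026-08-28, answers the critic's price 'name the additive quantity'):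
the ADDITIVE scale-invariant quantity is the weak-L³ quasi-norm λ³|{|u(t)|>λ}| (level-wise cell
count); bet = LorentzUpgradeTypeI (stmt-24108, crux r4: time-Type-I ⇒ Lorentz-Type-I,
sup_{t<T}‖u(t)‖_{L^{3,∞}} < ∞; open — Albritton–Barker arXiv:1811.00502 Remark 3.2; false for the
NSI cascade), then LorentzCountTypeI (stmt-24109, support: weak-L³ bound ⇒ the scale-uniform count,
printed-adjacent to Barker 2024 Thm 2 = tree fact barker2024_card_singular_points_weakL3_slices and
Barker–Prange 2021) and CountQuarterLaw (23971). Registered skeleton on 23726 with stubs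
stub_lorentzUpgrade / stub_lorentzCount / stub_countQuarterLaw. BARRIER NOTE (evidence memo on
23726/23970): the Scheffer–Ożański Type-I Cantor cascade (arXiv:1809.02109 Thm 1.6) has the sup-norm
Type-I rate with Z ≍ (T−t)^{-(1+ξ)/2}, N(τ^j) = M^j and λ³|{|u|>λ}| ≍ M^j, so K1, S1′,
FiniteScarsTypeI and LorentzUpgradeTypeI are false for the Navier–Stokes INEQUALITY: no NSI-valid
method (CKN, scaled-energy bookkeeping, concentration lower bounds) proves them; a proof must use
NSE-only structure (rigidity of the Type-I zoom limit, backward uniqueness, vorticity transport).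
LANDINGS OF RECORD (booked by name, KEY-NS #12): 23845 QuarterLawTypeIGlue — pub-ns-dss typer g29
(idle-row landing 2026-08-28T00:04:30Z, theorem typeIQuarterGate_quarterLawTypeIGlue_proof); 23727
QuarterZoom (typeIQuarterGate_quarterZoom_proof) and 23728 Assembly
(typeIQuarterGate_assembly_proof) by the prover/idle-row seats of record; 23844 EnvelopeQuarterLaw
PROVED by ns-tiqg-p1 (p590655; tools file Theorems/TypeIQuarterGateEnvelopeQuarterLawTools.lean);
ns-tiqg-p1's next items of record: 23970 then 23971 (KEY-NS #17 (A)); 0 provers on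
23842/23843/23726-direct/24108. LINE lorentz-upgrade card v2 (evidence on 24108): P-L1 =
Barker–Prange forward propagation under the global Lorentz bound + quantitative CKN, overlap
constant (2C+1)³; P-L2 = 24108 booked as the deciding crux of LINE D″ with the NSE-only technique
exclusion and the equivalent high-amplitude energy law E_{>λ}(t) ≤ C/λ (λ ≤ M/√(T−t)); the
multi-bump falsifier gives nothing at the level of identities, so 24108 stands as a clean open
problem (comparison of Type-I notions). DSS WALL — WORDING OF RECORD (KEY-NS #23 (B), 2026-08-28,
after refuter ns-dss-ref-1 g0): the EXACT locally-DSS Type-I blow-up (c-DSS inside a backward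
cylinder about the scar) is EMPTY for maximal solutions of the class — every slice is real-analytic
(lemarieRieusset2016_local_analyticity_holds + Oseen-mild uniqueness), the identity theorem makes
local exact DSS global, the L³ cube is orbit-invariant and slab-bounded, and the discharged ESS
criterion contradicts maximality: Theorems/QuarterLawTypeI/Negative/LocallyDssBlowupExcluded.lean
(QuarterLawTypeINegative.not_exists_locallyDssTypeIBlowupCollar, not_locallyDss_of_maximal,
dss_global_of_local; p593102, --supports 23726); exact global DSS LH blow-up is excluded
unconditionally (p591554). Consequently the tenure planner's exact-DSS stake lemmas (evidence
#10–#13 on 23726, #2 on 24108: K1 / 24108 'true on the object', QLP's SuperlogCubeRate 'false on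
it') are VACUOUS and are not to be landed (VACUITY-NOTICE, evidence #15). The honest wall object for
23843 ScarEnvelopeTypeI (and for QLP's 24077) is the ASYMPTOTICALLY (never exactly) locally-DSS
Type-I blow-up: zoom limit a backward c-DSS ancient solution with |v| ≤ C/(|x|+√(−s)) (Chae–Wolf
2017 Thm 1.1, tree ChaeWolfRemovingDSS*), c ≥ λ_*(C), C not small
(Literature/Barriers/NavierStokesRegularity/NearOneDssTypeIExclusion), existence open (Bradshaw–Tsai
arXiv:1811.00502 §§3–4); any stake lemma must be typed against THAT object with a quantified
convergence rate, and under its envelope K1 is the PROVED 23844 — so the single-scar template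
decides nothing beyond 23843, whose refutation needs a twin-scar / satellite-cascade local-energy
Type-I ancient solution realised from rapidly decaying data (none in print). Widths unchanged; 23843
stays 0 provers.

CHEAPEST FALSIFIER. Lookup, run 2026-08-27: is 'sup-norm Type-I rate ⇒ finitely many singular points
/ ⇒ L^(3,∞) bound' already in print (which would make half of K1 free) or refuted? `lit search
--hybrid "number of singular points Navier-Stokes Type I"` → arXiv:2111.14776 (Barker 2024, Proc.
AMS B): finiteness PROVED under the L^(3,∞) Type-I bound along a sequence of times (≤ C M^20
points), after ChoeWolfYang2018 and Seregin2001 (L³); nothing found for the sup-norm rate alone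
(queries below) — so K1 is open but its scar-counting half has a printed model. The cheapest kill of
the LINE is a local-energy Type-I ancient solution with two final-time scars (none in print:
galaxy/corpus null, see Novelty).

NUMBERS. Leray 1934 lower bound ‖∇u(t)‖₂ ≥ c ν^(3/4)(T−t)^(−1/4) (Z ≥ c²ν^(3/2)(T−t)^(−1/2)); in
tree leray_blowup_rate_top_holds. Small-constant regime of K1 already in tree via the sharp
strain-cube depletion |∫ωSω| ≤ κ‖u‖_∞ Z^(1/2) P^(1/2) (abs_integral_stretching_le_strainCube_sharp,
κ = (2+√3)/9): Ż ≤ κ²C²Z/(2ν(T−t)) integrates to Z ≤ Z₀((T−t₀)/(T−t))^(κ²C²/2ν), i.e. the quarter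
law holds outright for Type-I constants C ≤ √ν/κ — the same threshold as the STA ladder's reach
(constantForm_rung_ceiling C < 400/11); K1 is the statement for ALL C. Singular-point count under
L^(3,∞)-Type-I: ≤ C·M^20 (arXiv:2111.14776 Thm 3).

Novelty: Searches (2026-08-27): `lit search --hybrid "number of singular points Navier-Stokes Type I blow-up
time"` (12 docs; hit arXiv:2111.14776; Seregin2014 lecture notes p.172 = Seregin2001 CPAM 'On the
number of singular points'); `lit vsearch "Type I blow-up enstrophy grows no faster than Leray's
rate; finitely many singular points"` (12 book hits, none on the statement: robinson2016 pp.108–110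
Leray rate only, lemarie-rieusset2016 p.771 CKN only); `lit search 'interior regularity criteria
"number of singular points" Navier-Stokes' --source all` (local 8: arXiv:2111.14776,
arXiv:1510.02589; remote: doi:10.1007/s11854-014-0016-7 = WangZhang2014); `lit galaxy search "Type I
singularities of the Navier|Type I blow-up of the Navier|number of singular points of weak solutions
to the Navier" --star pdf` (1 irrelevant hit) and `--star all "number of singular points|Type I
singularit|Type I blow"` (24 rows, all off-topic); tree: rg over 124 Theses for 'quarter law|1574'
(6 routes, all use 1574 as a ceiling), 'finitely many singular|number of singular points' (4 routes:
HubbleDynamo, LandauTail, RellichScar, RobustBlowupPortability — none restricts the quarter law to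
Type-I or feeds Galdi's class), 'satellite' (0).
Nearest prior art found: route GaldiLiouvilleGate (stmt-0894 RecordZoomAncient: record-clock zoom
for ALL blow-ups) and arXiv:2111.14776 / ChoeWolfYang2018 (finite singular set under
L^(3,∞)-Type-I); KochNadirashviliSereginSverak2009 §6 (sup-norm zoom gives a bounded ancient s  [refs: 10.1007/s11854-014-0016-7, 2111.14776, 1510.02589, doi:10.1007/s11854-014-0016-7, Seregin2014, Seregin2001, KochNadirashviliSereginSverak2009]

Barriers (technique_class: blowup-rescaling, epsilon-regularity, liouville-rigidity): - technique_class: blowup-rescaling, epsilon-regularity, liouville-rigidity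
- Literature.Barriers.NavierStokesRegularity.AveragedTypeIBlowup: QuarterLawTypeI — OUTSIDE: a
Type-I blow-up exists for an autonomous averaged NS equation with the energy identity (tree theorem,
PerpetualPump crux 3), so any exclusion of Type-I blow-up must use structure beyond {energy
identity, scaling, symmetric cancellation}; K1's scar count and envelope rest on CKN-type
ε-regularity and the local energy inequality, which need the POINTWISE (local) nonlinearity u·∇u +
∇p — Tao's averaged bilinear forms are non-local Fourier-multiplier averages with no
partial-regularity theory, so the barrier does not quantify over K1's class; and the actual
exclusion of Type-I happens in the residual ParabolicGaldiLiouville (Liouville rigidity, also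
nonlinearity-specific). QuarterZoom — outside (compactness bookkeeping, no exclusion). NoTypeII —
residual, not advanced here.
- Literature.Barriers.NavierStokesRegularity.TaoAveragedBlowup: the averaged blow-up of Thm 1.5 is
Type-II; excluded from K1's hypothesis by `IsTypeIBlowup` and charged to the declared residual
NoTypeII.
- Step test (file Literature/Barriers/NavierStokesRegularity/AveragedEquationStepTest.lean,
vocabulary over the two averaged blow-ups): this line is not a two-step «a-priori bound ⊕
continuation» argument in the energy/Littlewood–Paley family; its typed steps (ε-regularity scar
count, KNSS zoom, Liouville) are not energy-class estimates and th

sub-problem: NavierStokesRegularity · status: open · opened planner-ns-idea-5-g2-0 2026-08-27T23:39:55Z · rev 8 · ledger route-NavierStokesRegularity-TypeIQuarterGate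
GENERATED by the gate from the ledger (D-0016/17). Provers cite these decls: `theorem foo : Summit.NavierStokesRegularity.NavierStokesRegularity.Theses.TypeIQuarterGate.<Decl> := …` in Summits/NavierStokesRegularity/NavierStokesRegularity/Theorems/<Name>.lean.
-/

namespace Summit.NavierStokesRegularity.NavierStokesRegularity.Theses.TypeIQuarterGate

open scoped BigOperators Topology Manifold Classical MeasureTheory ProbabilityTheory Matrix InnerProductSpace ComplexConjugate ContinuousMap
open Filter Set Function TopologicalSpace MeasureTheory

attribute [summit_statement] _root_.NavierStokesRegularity

open Literature.NS

/-- item stmt-NavierStokesRegularity-23726 · crux · rank 2 · SPLIT (gen 1) into FiniteScarsTypeI, ScarEnvelopeTypeI, EnvelopeQuarterLaw + glue QuarterLawTypeIGlue · direct attempts still welcome (low priority) · by planner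
why it might fail: a Type-I blow-up with infinitely many singular points at T, or whose KNSS profile carries 'satellite' near-singular bumps at all scales (a second scar on the unit sphere of the zoom limit), has Z√(T−t) → ∞ logarithmically while keeping the sup-norm rate.
sources: arXiv:2111.14776, ChoeWolfYang2018, doi:10.1002/cpa.3002, KochNadirashviliSereginSverak2009, arXiv:1811.00502, Leray1934
[crux] Leray's quarter rate on Type-I blow-ups: a maximal classical Leray–Hopf solution on ℝ³×[0,T)
from a rapidly decaying datum with the Type-I sup-norm rate has ∫|curl u(t)|² ≤ K/√(T−t) on [0,T)
(EnstrophyQuarterLaw stmt-1574 restricted to `IsTypeIBlowup`). [difficulty: XL] -/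
@[route_item "route-NavierStokesRegularity-TypeIQuarterGate", crux (bottleneck := idea) (source := "director NS l.128, 2026-09-01")]
def QuarterLawTypeI : Prop :=
  ∀ (ν T : ℝ), 0 < ν → 0 < T → ∀ (u : ℝ → EuclideanSpace ℝ (Fin 3) → EuclideanSpace ℝ (Fin 3)) (p : ℝ → EuclideanSpace ℝ (Fin 3) → ℝ), Literature.Analysis.FluidPDE.IsMaximalSmoothSolution ν 0 u p T → Literature.Analysis.FluidPDE.IsLerayHopfOn T ν 0 (u 0) u → Literature.Analysis.FluidPDE.HasRapidSpatialDecay (u 0) → Literature.Analysis.FluidPDE.IsTypeIBlowup u T → ∃ K : ℝ, ∀ t ∈ Set.Ico 0 T, ∫⁻ x, ‖Literature.Analysis.FluidPDE.curl (u t) x‖ₑ ^ 2 ≤ ENNReal.ofReal (K / Real.sqrt (T - t))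

-- parent: QuarterLawTypeI · child (gen 1)
/--     item stmt-NavierStokesRegularity-23842 · crux · rank 201 · open
    parent: QuarterLawTypeI · by planner
    why it might fail: the sup-norm rate alone may allow an accumulating sequence of singular points at T (scars of geometrically shrinking strength), since the scale-invariant count needs a Lorentz/L³-type bound the rate does not obviously give
    sources: arXiv:2111.14776, ChoeWolfYang2018, doi:10.1002/cpa.3002, arXiv:1811.00502, KochNadirashviliSereginSverak2009
[crux, split child 1 of QuarterLawTypeI; = registered stub_finiteScars of line scar-envelope] FINITE
SCARS: a sup-norm-rate Type-I maximal classical Leray–Hopf blow-up from a rapidly decaying datum has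
finitely many singular points at T — off a finite set σ every point is regular (velocity bounded on
a backward parabolic neighbourhood). Printed model: PROVED under the Lorentz Type-I bound sup_t
‖u(t)‖_{L^{3,∞}} ≤ M, even along a sequence of times (arXiv:2111.14776 Thm 3: ≤ C·M^20 points;
ChoeWolfYang2018; L³: Seregin2001); OPEN for the sup-norm rate IsTypeIBlowup (route: upgrade the
rate to a Lorentz bound along a time sequence, or count scars directly from the rate + local A–B
Type-I quantities, arXiv:1811.00502 Lemma 2.5). -/
@[route_item "route-NavierStokesRegularity-TypeIQuarterGate", crux]
def FiniteScarsTypeI : Prop :=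
  ∀ (ν T : ℝ), 0 < ν → 0 < T → ∀ (u : ℝ → EuclideanSpace ℝ (Fin 3) → EuclideanSpace ℝ (Fin 3)) (p : ℝ → EuclideanSpace ℝ (Fin 3) → ℝ), Literature.Analysis.FluidPDE.IsMaximalSmoothSolution ν 0 u p T → Literature.Analysis.FluidPDE.IsLerayHopfOn T ν 0 (u 0) u → Literature.Analysis.FluidPDE.HasRapidSpatialDecay (u 0) → Literature.Analysis.FluidPDE.IsTypeIBlowup u T → (∃ σ : Finset (EuclideanSpace ℝ (Fin 3)), ∀ x ∉ σ, ∃ r : ℝ, 0 < r ∧ ∃ A : ℝ, ∀ t ∈ Set.Ico (T - r ^ 2) T, ∀ y ∈ Metric.ball x r, ‖u t y‖ ≤ A)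

-- parent: QuarterLawTypeI · child (gen 1)
/--     item stmt-NavierStokesRegularity-23843 · crux · rank 202 · open
    parent: QuarterLawTypeI · by planner
    why it might fail: a Type-I profile with a second scar on the unit sphere of the zoom limit (twin-scar local-energy ancient solution) or satellites at a sparse set of scales defeats the compactness step: the finite count of child 1 need not pass to KNSS limits uniformly in the scale
    sources: arXiv:2607.09619, arXiv:1811.00502, KochNadirashviliSereginSverak2009, arXiv:2111.14776
[crux, split child 2 of QuarterLawTypeI, LOAD-BEARING new content; = registered
stub_envelopeAtScars] SCAR ENVELOPE ('no satellites'): finitely many scars + the sup-norm Type-I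
rate give the space-time envelope |u(x,t)| ≤ C' + Σ_{a∈σ} C'/(|x−a| + √(T−t)) on [0,T). Mechanism: a
violating sequence (x_k,t_k) with |x_k − a| ≫ √(T−t_k) KNSS-zooms to a local-energy Type-I ancient
solution (AlbrittonBarker2019 class) with a singular point off its blow-up axis at the final time;
scale invariance of the violation gives a satellite at every scale, i.e. infinitely many final-time
scars of the limit, against the scale-free finite count of child 1 passed to KNSS limits (stability
of singular points under local strong convergence via ε-regularity). One-scar envelope shape =
arXiv:2607.09619 (1.10). -/
@[route_item "route-NavierStokesRegularity-TypeIQuarterGate", crux]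
def ScarEnvelopeTypeI : Prop :=
  ∀ (ν T : ℝ), 0 < ν → 0 < T → ∀ (u : ℝ → EuclideanSpace ℝ (Fin 3) → EuclideanSpace ℝ (Fin 3)) (p : ℝ → EuclideanSpace ℝ (Fin 3) → ℝ), Literature.Analysis.FluidPDE.IsMaximalSmoothSolution ν 0 u p T → Literature.Analysis.FluidPDE.IsLerayHopfOn T ν 0 (u 0) u → Literature.Analysis.FluidPDE.HasRapidSpatialDecay (u 0) → Literature.Analysis.FluidPDE.IsTypeIBlowup u T → (∃ σ : Finset (EuclideanSpace ℝ (Fin 3)), ∀ x ∉ σ, ∃ r : ℝ, 0 < r ∧ ∃ A : ℝ, ∀ t ∈ Set.Ico (T - r ^ 2) T, ∀ y ∈ Metric.ball x r, ‖u t y‖ ≤ A) → (∃ (σ : Finset (EuclideanSpace ℝ (Fin 3))) (C' : ℝ), ∀ t ∈ Set.Ico 0 T, ∀ x, ‖u t x‖ ≤ C' + ∑ a ∈ σ, C' / (‖x - a‖ + Real.sqrt (T - t)))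

-- parent: QuarterLawTypeI · child (gen 1)
/--     item stmt-NavierStokesRegularity-23844 · support · rank 203 · closed · proved by Summit.NavierStokesRegularity.NavierStokesRegularity.Theorems.typeIQuarterGate_envelopeQuarterLaw_proof (prover)
    parent: QuarterLawTypeI · by planner
    sources: KochNadirashviliSereginSverak2009, Leray1934, arXiv:2607.09619
[support, split child 3 of QuarterLawTypeI; = registered stub_envelopeQuarter; the BC5 first rung of
the route, provable now, size L] ENVELOPE ⇒ QUARTER LAW: under the scar envelope a maximal classical
Leray–Hopf solution obeys ∫|curl u(t)|² ≤ K/√(T−t) on [0,T). Proof route: in the parabolic region of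
scar a, local regularity of bounded NS solutions on the cylinder of radius ρ/2 around (x,t), ρ =
|x−a| + √(T−t), where |u| ≤ 2C'/ρ (local Reynolds number O(C') fixed) gives |∇u(x,t)| ≤ K(C')
ρ^{-2}, and ∫_{B_δ(a)} ρ^{-4} dx ≲ (T−t)^{-1/2}; on the far region the velocity is bounded up to T,
∇u is uniformly bounded there (local regularity uniform in the base point), and the localised
enstrophy inequality closes by Gronwall on [T−δ², T). Sources: KochNadirashviliSereginSverak2009
(local regularity of bounded solutions), Leray1934. -/
@[route_item "route-NavierStokesRegularity-TypeIQuarterGate"]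
def EnvelopeQuarterLaw : Prop :=
  ∀ (ν T : ℝ), 0 < ν → 0 < T → ∀ (u : ℝ → EuclideanSpace ℝ (Fin 3) → EuclideanSpace ℝ (Fin 3)) (p : ℝ → EuclideanSpace ℝ (Fin 3) → ℝ), Literature.Analysis.FluidPDE.IsMaximalSmoothSolution ν 0 u p T → Literature.Analysis.FluidPDE.IsLerayHopfOn T ν 0 (u 0) u → Literature.Analysis.FluidPDE.HasRapidSpatialDecay (u 0) → (∃ (σ : Finset (EuclideanSpace ℝ (Fin 3))) (C' : ℝ), ∀ t ∈ Set.Ico 0 T, ∀ x, ‖u t x‖ ≤ C' + ∑ a ∈ σ, C' / (‖x - a‖ + Real.sqrt (T - t))) → ∃ K : ℝ, ∀ t ∈ Set.Ico 0 T, ∫⁻ x, ‖Literature.Analysis.FluidPDE.curl (u t) x‖ₑ ^ 2 ≤ ENNReal.ofReal (K / Real.sqrt (T - t))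

-- `EnvelopeQuarterLaw` holds: proved by `Summit.NavierStokesRegularity.NavierStokesRegularity.Theorems.typeIQuarterGate_envelopeQuarterLaw_proof` (its module imports this route file, so no `_holds` link can be stated here).

-- parent: QuarterLawTypeI · glue (gen 1)
/--     item stmt-NavierStokesRegularity-23845 · support · rank 204 · closed · proved by Summit.NavierStokesRegularity.NavierStokesRegularity.Theorems.typeIQuarterGate_quarterLawTypeIGlue_proof (prover)
    parent: QuarterLawTypeI · GLUE: children ⟹ parent · by planner
S1 → S2 → S3 → QuarterLawTypeI by composition (the registered skeleton Cruxes/QuarterLawTypeI line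
scar-envelope, theorem QuarterLawTypeI_of): finite scars → scar envelope → quarter law -/
@[route_item "route-NavierStokesRegularity-TypeIQuarterGate"]
def QuarterLawTypeIGlue : Prop :=
  FiniteScarsTypeI → ScarEnvelopeTypeI → EnvelopeQuarterLaw → QuarterLawTypeI

-- `QuarterLawTypeIGlue` holds: proved by `Summit.NavierStokesRegularity.NavierStokesRegularity.Theorems.typeIQuarterGate_quarterLawTypeIGlue_proof` (its module imports this route file, so no `_holds` link can be stated here).

/-- item stmt-NavierStokesRegularity-0893 · crux · rank 3 · open · by planner
why it might fail: contains Galdi's open steady Liouville problem (D-solutions; no decay rate beyond L⁶/L^(9/2) known) and the slow |x|^(−a), a ∈ (1/2,2/3) tails; one nontrivial finite-enstrophy ancient or time-periodic flow refutes it.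
sources: Galdi2011, KochNadirashviliSereginSverak2009, Seregin2016, ChaeWolf2019, arXiv:2608.06040
[crux] X2, PARABOLIC GALDI–LIOUVILLE (card enstrophy-record-galdi-bridge X2): a bounded ancient mild
solution v of NS (ν=1) on ℝ³×(−∞,0) (in-tree IsBoundedAncientMildSolution 1 v), smooth on (−∞,0)×ℝ³,
with UNIFORMLY BOUNDED ENSTROPHY sup_{s<0} ∫|∇v(s)|² ≤ C and v(s) ∈ L⁶ for every s<0, vanishes
identically. Weaker than KNSS (L) (stmt-0057: such v are bounded and L⁶ kills the constants that
make (L) delicate), stronger than Galdi's steady D-solution Liouville problem (its steady case =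
crux GaldiLiouville) and than Type-I exclusion (a Type-I ancient solution shifted by one time unit
has bounded enstrophy ~(−t)^{-1/2}). Rungs foreseen (layer 2, not filed): steady (GaldiLiouville),
time-periodic finite-enstrophy flows, eternal flows with an attained enstrophy maximum (threshold
device (T) of the card, GallagherIftimiePlanchon2003), general ancient; first calibration:
axisymmetric class (Lei–Ren–Zhang-type ancient Liouville). Tools named by the cards: Seregin2016
(BMO^{-1}), ChaeWolf2019, KTW JFA 272 (2017), head-flux identity + inviscid blow-down at rate 2/3
(crux CriticalRateLiouville) transported to the time-dependent setting (card
critical-rate-galdi-gate corollary (ii): an ancien -/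
@[route_item "route-NavierStokesRegularity-TypeIQuarterGate", crux]
def ParabolicGaldiLiouville : Prop :=
  ∀ v : ℝ → EuclideanSpace ℝ (Fin 3) → EuclideanSpace ℝ (Fin 3), Literature.Analysis.FluidPDE.IsBoundedAncientMildSolution 1 v → ContDiffOn ℝ (⊤ : ℕ∞) (Function.uncurry v) (Set.Iio 0 ×ˢ Set.univ) → (∃ C : NNReal, ∀ s < 0, ∫⁻ y, ENNReal.ofReal (Literature.Analysis.FluidPDE.frobeniusNormSq (fderiv ℝ (v s) y)) ≤ C) → (∀ s < 0, MeasureTheory.MemLp (v s) 6 MeasureTheory.volume) → ∀ s < 0, ∀ y, v s y = 0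

/-- item stmt-NavierStokesRegularity-23970 · crux · rank 3 · open · by planner
why it might fail: Sup-norm rate gives no time-uniform quantity summable over disjoint parabolic cylinders (energy: N(t) ≲ M·E₀/(η√(T−t)) only); a Type-I blow-up with unboundedly many simultaneous concentration scales (dense satellites, log-divergent profile enstrophy) breaks the count.
sources: arXiv:2111.14776, ChoeWolfYang2018, CaffarelliKohnNirenberg1982, arXiv:1811.00502, Leray1934
[crux · registered stub stub_uniformCount of line uniform-count on 23726] [crux, resplit child 1 =
S1′ of critic idea-crit-3 (re-verdict 23:59Z P1/P3), THE DECIDING CRUX, closest to print]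
SCALE-UNIFORM ε-CONCENTRATION COUNT under the sup-norm Type-I rate: for a maximal classical
Leray–Hopf solution with Type-I blow-up at T and every threshold η > 0 there are N and r₀ > 0 such
that at EVERY scale r ≤ r₀ any family of points with pairwise disjoint balls B_r whose backward
parabolic cylinders Q_r(x,T) = B_r(x) × (T − r², T) carry scaled dissipation (1/r)∬_{Q_r}|∇u|² ≥ η
has at most N members (N independent of r). This is exactly the FORM in which the
finite-singular-set theorem is PRINTED under the Lorentz-critical Type-I bound sup_t ‖u‖_{L^{3,∞}} ≤
M (at most C·M^20 ε-concentrating cylinders per scale; arXiv:2111.14776 Thm 3 p.3–4, after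
Choe–Wolf–Yang 2018) and it is OPEN under the sup-norm rate; gauge-free (gradient functional,
lintegral; r₀ ≤ √T is the prover's choice so no negative-time junk). Equivalent to the parent K1
modulo provable glue in BOTH directions (K1 ⇒ it: Σ_i (1/r)∬_{Q_r(x_i,T)}|∇u|² ≤ (1/r)∫_{T−r²}^T Z ≤
2K, so N ≤ 2K/η; it ⇒ K1: CountQuarterLaw below) — an hones -/
@[route_item "route-NavierStokesRegularity-TypeIQuarterGate", crux]
def UniformConcentrationCountTypeI : Prop :=
  ∀ (ν T : ℝ), 0 < ν → 0 < T → ∀ (u : ℝ → EuclideanSpace ℝ (Fin 3) → EuclideanSpace ℝ (Fin 3)) (p : ℝ → EuclideanSpace ℝ (Fin 3) → ℝ), Literature.Analysis.FluidPDE.IsMaximalSmoothSolution ν 0 u p T → Literature.Analysis.FluidPDE.IsLerayHopfOn T ν 0 (u 0) u → Literature.Analysis.FluidPDE.HasRapidSpatialDecay (u 0) → Literature.Analysis.FluidPDE.IsTypeIBlowup u T → (∀ η : ℝ, 0 < η → ∃ N : ℕ, ∃ r₀ : ℝ, 0 < r₀ ∧ ∀ r : ℝ, 0 < r → r ≤ r₀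 → ∀ σ : Finset (EuclideanSpace ℝ (Fin 3)), (∀ x ∈ σ, ∀ x' ∈ σ, x ≠ x' → 2 * r ≤ ‖x - x'‖) → (∀ x ∈ σ, ENNReal.ofReal (η * r) ≤ ∫⁻ s in Set.Ioo (T - r ^ 2) T, ∫⁻ y in Metric.ball x r, ENNReal.ofReal (Literature.Analysis.FluidPDE.frobeniusNormSq (fderiv ℝ (u s) y))) → σ.card ≤ N)

/-- item stmt-NavierStokesRegularity-0056 · crux · rank 4 · open · by planner
why it might fail: a Schwartz-data Type-II blow-up (Euler-driven collapse faster than √(T−t), Hou-type scenarios; Tao's averaged cascade is Type-II) refutes it; shared fate with TypeILiouville, RecurrentProfiles, ExtremiserTransience.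
sources: KochNadirashviliSereginSverak2009, arXiv:1402.0290, doi:10.1007/s10208-026-09748-8
If a finite-energy classical solution from a rapidly decaying datum has maximal lifespan T<∞ (no
classical extension past T), then ‖u(t)‖_∞ ≤ C (T−t)^{-1/2} eventually as t↑T (Leray's rate is the
matching lower bound, leray_blowup_rate_top). The hardest and most informative crux: a
counterexample is a Type II singularity, i.e. ¬(Clay A). Known: lower bound c√ν (T−t)^{-1/2} (Leray
1934 §20); L³ must blow up (ESS 2003, Seregin 2012); only triple-log quantitative gain (Tao 2021). -/
@[route_item "route-NavierStokesRegularity-TypeIQuarterGate", crux]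
def NoTypeII : Prop :=
  ∀ (ν T : ℝ), 0 < ν → 0 < T → ∀ (u : ℝ → EuclideanSpace ℝ (Fin 3) → EuclideanSpace ℝ (Fin 3)) (p : ℝ → EuclideanSpace ℝ (Fin 3) → ℝ), Literature.Analysis.FluidPDE.IsMaximalSmoothSolution ν 0 u p T → Literature.Analysis.FluidPDE.IsLerayHopfOn T ν 0 (u 0) u → Literature.Analysis.FluidPDE.HasRapidSpatialDecay (u 0) → Literature.Analysis.FluidPDE.IsTypeIBlowup u T

/-- item stmt-NavierStokesRegularity-24108 · crux · rank 4 · open · by planner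
why it might fail: Intermediate-amplitude clouds (|u| ≍ λ ≪ M/√(T−t) on volume ≫ λ⁻³) respect the sup-norm rate and the energy bound |{|u|>λ}| ≤ E₀/λ² (so λ³|{|u|>λ}| ≤ E₀λ → ∞); the NSI Type-I Cantor cascade (arXiv:1809.02109 Thm 1.6) realises this: λ³|{|u|>λ}| ≍ M^j.
sources: arXiv:1811.00502, arXiv:2111.14776, BarkerPrange2021, arXiv:1809.02109, Leray1934
[crux · registered stub stub_lorentzUpgrade of line lorentz-upgrade on 23726; names the ADDITIVE
scale-invariant quantity asked for by critic idea-crit-3 2026-08-28T00:21Z] TIME-TYPE-I ⇒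
LORENTZ-TYPE-I: a maximal classical Leray–Hopf solution from a rapidly decaying datum with the
sup-norm Type-I rate at T has uniformly bounded weak-L³ slices, sup_{t<T} sup_λ λ³|{|u(t)|>λ}| < ∞
(eWeakLpPow (u t) 3 ≤ M′). The weak-L³ quasi-norm is the level-wise count of cells, additive over
disjoint sets at a common level — the pigeonhole quantity that Barker 2024 Thm 2 (tree fact
barker2024_card_singular_points_weakL3_slices: ≤ C·M^20 blow-up points) and the per-scale
ε-concentration count consume; with it, S1′ (23970) is printed-adjacent (LorentzCountTypeI) and the
quarter law follows by CountQuarterLaw (23971). OPEN: Albritton–Barker arXiv:1811.00502 Remark 3.2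
singles out p = ∞ (the sup-norm rate) as the Type-I notion not known to control the scale-invariant
energies without an energy class, and no comparison (c_∞) ⇒ L^{3,∞} is in print; FALSE for the
Navier–Stokes inequality (Scheffer–Ożański Type-I Cantor cascade: λ³|{|u|>λ}| ≍ M^j at λ ≍ τ^{-j}),
so a proof must use NSE-only structure. Stron -/
@[route_item "route-NavierStokesRegularity-TypeIQuarterGate", crux]
def LorentzUpgradeTypeI : Prop :=
  ∀ (ν T : ℝ), 0 < ν → 0 < T → ∀ (u : ℝ → EuclideanSpace ℝ (Fin 3) → EuclideanSpace ℝ (Fin 3)) (p : ℝ → EuclideanSpace ℝ (Fin 3) → ℝ), Literature.Analysis.FluidPDE.IsMaximalSmoothSolution ν 0 u p T → Literature.Analysis.FluidPDE.IsLerayHopfOn T ν 0 (u 0) u → Literature.Analysis.FluidPDE.HasRapidSpatialDecay (u 0) → Literature.Analysis.FluidPDE.IsTypeIBlowup u T → (∃ M' : ℝ, ∀ t ∈ Set.Ico 0 T, Literature.Analysis.FunctionSpaces.eWeakLpPow (u t) 3 MeasureTheory.volume ≤ ENNReal.ofReal M')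

/-- item stmt-NavierStokesRegularity-23727 · support · rank 9 · closed · proved by Summit.NavierStokesRegularity.NavierStokesRegularity.Theorems.typeIQuarterGate_quarterZoom_proof (prover) · by planner
sources: KochNadirashviliSereginSverak2009, arXiv:1811.00502, Galdi2011
[support] QUARTER ZOOM (bookkeeping): under NoTypeII and QuarterLawTypeI, a non-extendable
Leray–Hopf classical solution from a rapidly decaying datum has a KNSS zoom limit which is a
NONTRIVIAL bounded ancient mild solution (ν = 1), smooth, with slice enstrophy ≤ 1 and L⁶ slices
(conclusion = GaldiLiouvilleGate.RecordZoomAncient verbatim). Steps: KNSS zoom at the sup-norm scale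
λ_k ~ √(T−t_k) (KNSS2009_blowup_generates_ancient_holds); ∫|∇u_λ|² = λ∫|∇u|² so the quarter law
gives ∫|∇v_k(s)|² ≤ K/√(1−s) ≤ K for s ≤ 0; weak lower semicontinuity of the Ḣ¹ seminorm; NS-rescale
by K to normalise to 1; parabolic smoothing of bounded mild solutions; Ḣ¹ ∩ (local L² average → 0 at
infinity, from finite energy via A–B Lemma 2.5) ⇒ L⁶. [difficulty: L] -/
@[route_item "route-NavierStokesRegularity-TypeIQuarterGate", crux]
def QuarterZoom : Prop :=
  NoTypeII → QuarterLawTypeI → ∀ (ν T : ℝ), 0 < ν → 0 < T → ∀ (u : ℝ → EuclideanSpace ℝ (Fin 3) → EuclideanSpace ℝ (Fin 3)) (p : ℝ → EuclideanSpace ℝ (Fin 3) → ℝ), Literature.Analysis.FluidPDE.IsClassicalNSSolutionOn (Set.Ico 0 T) ν 0 u p → Literature.Analysis.FluidPDE.IsLerayHopfOn T ν 0 (u 0) u → Literature.Analysis.FluidPDE.HasRapidSpatialDecay (u 0) → ¬ Literature.Analysis.FluidPDE.HasSmoothExtensionPast ν 0 u T → ∃ v : ℝ → EuclideanSpace ℝ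 (Fin 3) → EuclideanSpace ℝ (Fin 3), Literature.Analysis.FluidPDE.IsBoundedAncientMildSolution 1 v ∧ ContDiffOn ℝ (⊤ : ℕ∞) (Function.uncurry v) (Set.Iio 0 ×ˢ Set.univ) ∧ (∀ s < 0, ∫⁻ y, ENNReal.ofReal (Literature.Analysis.FluidPDE.frobeniusNormSq (fderiv ℝ (v s) y)) ≤ 1) ∧ (∀ s < 0, MeasureTheory.MemLp (v s) 6 MeasureTheory.volume) ∧ ¬ (∀ s < 0, ∀ y, v s y = 0)

-- `QuarterZoom` holds: proved by `Summit.NavierStokesRegularity.NavierStokesRegularity.Theorems.typeIQuarterGate_quarterZoom_proof` (its module imports this route file, so no `_holds` link can be stated here).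

/-- item stmt-NavierStokesRegularity-23912 · support · rank 9 · closed · proved by Summit.NavierStokesRegularity.NavierStokesRegularity.Theorems.typeIQuarterGate_quarterLawCountsScars_proof (prover) · by planner
[support, provable now, size L; critic idea-crit-3 P3 'reach rung' glue] THE QUARTER LAW COUNTS
SCARS: a classical Leray–Hopf solution on [0,T) from a rapidly decaying datum obeying ∫|curl u(t)|²
≤ K/√(T−t) has finitely many singular points at T (off a finite set σ the velocity is bounded on a
backward parabolic neighbourhood) — indeed #σ ≤ 2K/(ε₁ν-normalised): by CKN Theorem B (tree:
Literature/Analysis/FluidPDE/CKNTheoremB.lean, PartialRegularity.lean; classical LH solutions are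
suitable, ClassicalSuitable.lean) each singular point x_i costs ∫_{T−r²}^{T}∫_{B_r(x_i)}|∇u|² ≥ ε₁ r
for all small r (disjoint balls), while the quarter law pays ∫_{T−r²}^{T} Z dt ≤ 2K r. Hence K1
QuarterLawTypeI ⇒ the conclusion of FiniteScarsTypeI (stmt-23842): the open rung 'finite singular
set under the sup-norm Type-I rate' (settled only under L^{3,∞}: arXiv:2111.14776 Thm 3) is reached
from K1 by provable glue. No Type-I hypothesis needed. Sources: CaffarelliKohnNirenberg1982 Prop 2 /
Thm B; arXiv:2111.14776; Leray1934. -/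
@[route_item "route-NavierStokesRegularity-TypeIQuarterGate"]
def QuarterLawCountsScars : Prop :=
  ∀ (ν T : ℝ), 0 < ν → 0 < T → ∀ (u : ℝ → EuclideanSpace ℝ (Fin 3) → EuclideanSpace ℝ (Fin 3)) (p : ℝ → EuclideanSpace ℝ (Fin 3) → ℝ), Literature.Analysis.FluidPDE.IsClassicalNSSolutionOn (Set.Ico 0 T) ν 0 u p → Literature.Analysis.FluidPDE.IsLerayHopfOn T ν 0 (u 0) u → Literature.Analysis.FluidPDE.HasRapidSpatialDecay (u 0) → ∀ K : ℝ, (∀ t ∈ Set.Ico 0 T, ∫⁻ x, ‖Literature.Analysis.FluidPDE.curl (u t) x‖ₑ ^ 2 ≤ ENNReal.ofReal (K / Real.sqrt (T - t))) → ∃ σ : Finset (EuclideanSpace ℝ (Fin 3)), ∀ x ∉ σ, ∃ r : ℝ, 0 < r ∧ ∃ A : ℝ, ∀ t ∈ Set.Ico (T - r ^ 2) T, ∀ y ∈ Metric.ball x r, ‖u t y‖ ≤ A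

-- `QuarterLawCountsScars` holds: proved by `Summit.NavierStokesRegularity.NavierStokesRegularity.Theorems.typeIQuarterGate_quarterLawCountsScars_proof` (its module imports this route file, so no `_holds` link can be stated here).

/-- item stmt-NavierStokesRegularity-23971 · support · rank 9 · closed · proved by Summit.NavierStokesRegularity.NavierStokesRegularity.Theorems.typeIQuarterGate_countQuarterLaw_proof (prover) · by planner
[support · registered stub stub_countQuarterLaw of line uniform-count on 23726] [support, provable
mathematics (M/L-math, XL-Lean), resplit child 2 = the summation glue that lets S1′ replace the
envelope] COUNT ⇒ QUARTER LAW under Type-I: fix t = T − ρ²; (i) Type-I local smoothing gives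
|∇u(t,·)| ≤ C_M ρ^{−2} everywhere; (ii) at dyadic scales r_k = 8·2^k ρ ≤ r₀ take a maximal disjoint
family F_k of η-concentrating cylinders (|F_k| ≤ N by the count); every x outside ⋃_{F_k} B_{2
r_k}(x_i) has (1/r_k)∬_{Q_{r_k}(x,T)}|∇u|² < η, whence — using the Type-I bounds on all scaled CKN
quantities (Albritton–Barker arXiv:1811.00502 Lemma 2.5) and the CKN interpolation C(θr) ≤
c[θ³A^{3/2} + θ^{−3}A^{3/4}δ^{3/4}], D(θr) ≤ c[θD + θ^{−2}C] — ε-regularity at scale θ²r_k (tree: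
CKNTheoremB / CKNLocalRegularityRRS / CKNOneScaleFromRRS) and the interior gradient estimate
|∇u(t,x)| ≤ C r_k^{−2}; (iii) summing: Z(t) ≤ N·Cρ³·C_M²ρ^{−4} + Σ_k N·C r_{k+1}³·C r_k^{−4} + (|x|
≤ R_far, regular at scale r₀: O(1)) + far-field enstrophy (bounded up to T by far-field regularity +
localised enstrophy Gronwall on [0,T)) ≤ C + C′N/√(T−t). No envelope / space-Type-I is used (critic
P3: satellites at different times d -/
@[route_item "route-NavierStokesRegularity-TypeIQuarterGate"]
def CountQuarterLaw : Prop :=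
  ∀ (ν T : ℝ), 0 < ν → 0 < T → ∀ (u : ℝ → EuclideanSpace ℝ (Fin 3) → EuclideanSpace ℝ (Fin 3)) (p : ℝ → EuclideanSpace ℝ (Fin 3) → ℝ), Literature.Analysis.FluidPDE.IsMaximalSmoothSolution ν 0 u p T → Literature.Analysis.FluidPDE.IsLerayHopfOn T ν 0 (u 0) u → Literature.Analysis.FluidPDE.HasRapidSpatialDecay (u 0) → Literature.Analysis.FluidPDE.IsTypeIBlowup u T → (∀ η : ℝ, 0 < η → ∃ N : ℕ, ∃ r₀ : ℝ, 0 < r₀ ∧ ∀ r : ℝ, 0 < r → r ≤ r₀ → ∀ σ : Finset (EuclideanSpace ℝ (Fin 3)), (∀ x ∈ σ, ∀ x' ∈ σ, x ≠ x' → 2 * r ≤ ‖x - x'‖) → (∀ x ∈ σ, ENNReal.ofReal (η * r) ≤ ∫⁻ s in Set.Ioo (T - r ^ 2) T, ∫⁻ y in Metric.ball x r, ENNReal.ofReal (Literature.Analysis.FluidPDE.frobeniusNormSq (fderiv ℝ (u s) y))) → σ.card ≤ N) → ∃ K : ℝ, ∀ t ∈ Set.Ico 0 T, ∫⁻ x,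 ‖Literature.Analysis.FluidPDE.curl (u t) x‖ₑ ^ 2 ≤ ENNReal.ofReal (K / Real.sqrt (T - t))

-- `CountQuarterLaw` holds: proved by `Summit.NavierStokesRegularity.NavierStokesRegularity.Theorems.typeIQuarterGate_countQuarterLaw_proof` (its module imports this route file, so no `_holds` link can be stated here).

/-- item stmt-NavierStokesRegularity-24109 · support · rank 9 · closed · proved by Summit.NavierStokesRegularity.NavierStokesRegularity.Theorems.CountQuarterLaw.stub_lorentzCount (prover) · by planner
[support · registered stub stub_lorentzCount of line lorentz-upgrade on 23726; printed-adjacent,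
L-math / XL-Lean] LORENTZ BOUND ⇒ SCALE-UNIFORM CONCENTRATION COUNT: under the hypotheses of K1 plus
a uniform weak-L³ bound on the slices, for every η > 0 there are N, r₀ with at most N
pairwise-2r-separated points whose cylinders Q_r(x,T) carry (1/r)∬|∇u|²_F ≥ η, at every scale r ≤
r₀. Route: an η-concentrating cylinder at scale r is ε-irregular at scale r in the Barker–Prange
quantitative sense, hence (backward concentration, Barker–Prange 2021 / Barker 2024 §2) carries
weak-L³ mass ≥ c(η, M′) at the common level ≍ 1/r on B_{Cr}(x_i) at the common time T − c r²;
additivity of λ³|{|u|>λ} ∩ B_i| over the disjoint balls against λ³|{|u|>λ}| ≤ M′ bounds the count by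
N ≤ M′/c. WHY IT MIGHT FAIL: provable; the Lean port needs the quantitative Barker–Prange
concentration (not yet in the tree beyond the named facts
barkerPrange2021_typeI_regular_of_small_weakL3 / barker2024_card_singular_points_weakL3_slices).
SOURCES: arXiv:2111.14776, BarkerPrange2021, arXiv:1811.00502. -/
@[route_item "route-NavierStokesRegularity-TypeIQuarterGate"]
def LorentzCountTypeI : Prop :=
  ∀ (ν T : ℝ), 0 < ν → 0 < T → ∀ (u : ℝ → EuclideanSpace ℝ (Fin 3) → EuclideanSpace ℝ (Fin 3)) (p : ℝ → EuclideanSpace ℝ (Fin 3) → ℝ), Literature.Analysis.FluidPDE.IsMaximalSmoothSolution ν 0 u p T → Literature.Analysis.FluidPDE.IsLerayHopfOn T ν 0 (u 0) u → Literature.Analysis.FluidPDE.HasRapidSpatialDecay (u 0) → Literature.Analysis.FluidPDE.IsTypeIBlowup u T → (∃ M' : ℝ, ∀ t ∈ Set.Ico 0 T, Literature.Analysis.FunctionSpaces.eWeakLpPow (u t) 3 MeasureTheory.volume ≤ ENNReal.ofReal M') → (∀ η : ℝ, 0 < η → ∃ N : ℕ, ∃ r₀ : ℝ, 0 < r₀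 ∧ ∀ r : ℝ, 0 < r → r ≤ r₀ → ∀ σ : Finset (EuclideanSpace ℝ (Fin 3)), (∀ x ∈ σ, ∀ x' ∈ σ, x ≠ x' → 2 * r ≤ ‖x - x'‖) → (∀ x ∈ σ, ENNReal.ofReal (η * r) ≤ ∫⁻ s in Set.Ioo (T - r ^ 2) T, ∫⁻ y in Metric.ball x r, ENNReal.ofReal (Literature.Analysis.FluidPDE.frobeniusNormSq (fderiv ℝ (u s) y))) → σ.card ≤ N)

/-- `LorentzCountTypeI` holds: proved by `Summit.NavierStokesRegularity.NavierStokesRegularity.Theorems.CountQuarterLaw.stub_lorentzCount`. -/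
theorem LorentzCountTypeI_holds : LorentzCountTypeI := _root_.Summit.NavierStokesRegularity.NavierStokesRegularity.Theorems.CountQuarterLaw.stub_lorentzCount

/-- item stmt-NavierStokesRegularity-23728 · assembly · rank 1 · closed · proved by Summit.NavierStokesRegularity.NavierStokesRegularity.Theorems.typeIQuarterGate_assembly_proof (prover) · by planner
sources: KochNadirashviliSereginSverak2009, Galdi2011
[assembly] QuarterLawTypeI → QuarterZoom → ParabolicGaldiLiouville → NoTypeII →
NavierStokesRegularity. -/
@[route_item "route-NavierStokesRegularity-TypeIQuarterGate"]
def Assembly : Prop :=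
  QuarterLawTypeI → QuarterZoom → ParabolicGaldiLiouville → NoTypeII → NavierStokesRegularity

-- `Assembly` holds: proved by `Summit.NavierStokesRegularity.NavierStokesRegularity.Theorems.typeIQuarterGate_assembly_proof` (its module imports this route file, so no `_holds` link can be stated here).

/-! D-0027 §2.1 — DECIDING THEOREM (planner-authored via `route open/edit --closes-file`; by planner-ns-idea-5-g2-0 2026-08-27T23:39:55Z):
its hypotheses are this route's items and its conclusion the sub-problem Statement (glue_lint), and it elaborates with this file. -/

@[closes "route-NavierStokesRegularity-TypeIQuarterGate"] theorem closes (hQ : QuarterLawTypeI) (hZ : QuarterZoom) (hP : ParabolicGaldiLiouville)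
    (hII : NoTypeII) : NavierStokesRegularity := by
  apply Summit.NavierStokesRegularity.NavierStokesRegularity.Theorems.navierStokesRegularity_of_noBlowup
  intro ν T hν hT u p hcl hLH hdec
  by_contra hext
  obtain ⟨v, hv, hsm, hens, hL6, hne⟩ := hZ hII hQ ν T hν hT u p hcl hLH hdec hext
  exact hne (hP v hv hsm ⟨1, fun s hs => le_of_le_of_eq (hens s hs) ENNReal.coe_one.symm⟩ hL6)

end Summit.NavierStokesRegularity.NavierStokesRegularity.Theses.TypeIQuarterGate
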